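import Mathlib
import Literature.NumberTheory.DiophantineGeometry.BelyiLemma

/-!
# Proof of Belyi's lemma in genus `0` over `ℚ` (`BelyiLemmaGenusZero_holds`)

This file discharges the named fact
`Literature.NumberTheory.DiophantineGeometry.BelyiLemmaGenusZero` of `BelyiLemma.lean`
([BombieriGubler2006, Lemma 12.2.7 "Belyi's lemma", statement p. 405, proof pp. 405–406, read on
the held copy]; originally [Belyi1980]) by the theorem `BelyiLemmaGenusZero_holds`.  No statement
is changed; this file only adds proofs.

## The argument (Bombieri–Gubler, proof of Lemma 12.2.7, pp. 405–406), as formalised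

We follow the printed "descending double induction" with one simplification flagged below: the
Belyi function produced is a POLYNOMIAL `h ∈ ℚ[x]` (so `q = 1`, `h(∞) = ∞`, and the fact's
ramification clause becomes `h'(z) = 0 → h(z) ∈ {0,1}` at every `z ∈ ℂ`).

* **Step 1, "Lowering the degree of a point in S"** (`BelyiAlgorithm.step1`).  For a finite set
  `S ⊂ ℂ` of algebraic numbers there is a non-constant `g ∈ ℚ[x]` with `g(S) ⊂ ℚ` and all (finite)
  critical values of `g` in `ℚ`.  As printed: pick `α ∈ S` of highest degree `d + 1 ≥ 2`, let `p`
  be its minimal polynomial, `S₁` = roots of `p'` (degree `≤ d`), and replace `S` by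
  `S' = p(S ∪ S₁)` (`BelyiAlgorithm.step1_reduce`); since `p(α) = 0` and `deg_ℚ p(β) ≤ deg_ℚ β`
  (`BelyiAlgorithm.natDegree_minpoly_aeval_le`, via `[ℚ(β):ℚ] = deg minpoly`), the number of
  points of degree `d + 1` drops (inner induction, `BelyiAlgorithm.step1_succ`), and when it
  reaches `0` the top degree drops (outer induction on `d`, `BelyiAlgorithm.step1`); the chain rule
  (`Polynomial.derivative_comp`) carries the bookkeeping through compositions
  (`BelyiAlgorithm.step1_comp`).  Base: all points rational, `g = x`.
* **Step 2, "Lowering the cardinality of S"** (`BelyiAlgorithm.step2`).  For a finite `T ⊂ ℚ`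
  there is a non-constant `f ∈ ℚ[x]` with `f(T) ⊆ {0,1}` and critical values in `{0,1}`, by
  induction on `|T|`.  `|T| ≤ 2`: an affine map (`BelyiAlgorithm.affine_props`).  `|T| ≥ 3`: the
  printed proof moves three points to `0, 1, ∞` by a projective automorphism and uses
  `h = c x^A (1-x)^B` with `λ = A/(A+B)` a fourth point, `c = λ^{-A}(1-λ)^{-B}`,
  `h'/h = A/x - B/(1-x)` vanishing only at `λ` (and `∞`), `h(λ) = 1`.  DEVIATION (genuinely
  shorter in Lean, same idea): we keep `∞` fixed and use the AFFINE automorphism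
  `x ↦ (x - min T)/(max T - min T)`, so that a third point `t₀` goes to `λ ∈ (0,1) ∩ ℚ`, i.e.
  `λ = (m+1)/(m+n+2)` with `A = m+1, B = n+1 > 0`
  (`BelyiAlgorithm.exists_nat_eq_div_of_pos_lt_one`) and `h` is a polynomial; the logarithmic
  derivative identity is `BelyiAlgorithm.belyiPoly_derivative_mul`, the ramification statement
  `BelyiAlgorithm.belyiPoly_critical`, `h(λ) = 1` is `BelyiAlgorithm.belyiPoly_eval_lambda`.
  Composition sends `min T, max T, t₀ ↦ 0, 0, 1`, so `|h(T)| < |T|`.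
* **Assembly** (`BelyiAlgorithm.exists_belyi_polynomial`, `BelyiLemmaGenusZero_holds`): with
  `T = g(S ∪ {roots of g'}) ⊂ ℚ` (a `Finset.preimage` under `algebraMap ℚ ℂ`), `h = f ∘ g`; the
  chain rule again (`BelyiAlgorithm.comp_critical`).

## Not here

* Rational (non-polynomial) Belyi functions, the general Lemma 12.2.7 for curves `C → C'`, and
  Belyi's theorem 12.3.11 — see the module docstring of `BelyiLemma.lean`.
* Degree / height bounds for `h` (the construction is far from optimal, cf. Example 12.2.8).

## References

* [BombieriGubler2006] E. Bombieri, W. Gubler, Heights in Diophantine Geometry, CUP (2006),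
  Lemma 12.2.7, pp. 405–406.
* [Belyi1980] G. V. Belyĭ, On Galois extensions of a maximal cyclotomic field, Math. USSR Izv. 14
  (1980) 247–256.
-/

namespace Literature.NumberTheory.DiophantineGeometry

open Polynomial IntermediateField

namespace BelyiAlgorithm

/-! ### Degree bookkeeping over `ℚ`
(Bombieri–Gubler p. 405: "`p(β)` has degree not exceeding the degree of `β`") -/

/-- If `x` is integral over `ℚ` then so is `P(x)`. [folklore] -/
theorem isIntegral_aeval {x : ℂ} (hx : IsIntegral ℚ x) (P : ℚ[X]) :
    IsIntegral ℚ (aeval x P) :=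
  .of_mem_of_fg _ hx.fg_adjoin_singleton _ (aeval_mem_adjoin_singleton _ _)

/-- `deg_ℚ P(x) ≤ deg_ℚ x`: the degree over `ℚ` does not go up under a rational polynomial map
(Bombieri–Gubler, proof of Lemma 12.2.7: "`p(β)` has degree not exceeding the degree of `β`").
[cite: BombieriGubler2006, Lemma 12.2.7 (proof, p. 405)] -/
theorem natDegree_minpoly_aeval_le {x : ℂ} (hx : IsIntegral ℚ x) (P : ℚ[X]) :
    (minpoly ℚ (aeval x P)).natDegree ≤ (minpoly ℚ x).natDegree := by
  haveI := IntermediateField.adjoin.finiteDimensional hx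
  have hmem : aeval x P ∈ ℚ⟮x⟯ :=
    IntermediateField.algebra_adjoin_le_adjoin ℚ {x} (aeval_mem_adjoin_singleton ℚ x)
  set y : ℚ⟮x⟯ := ⟨aeval x P, hmem⟩ with hy
  have h1 : minpoly ℚ (aeval x P) = minpoly ℚ y := by
    have := minpoly.algebraMap_eq (A := ℚ) (algebraMap ℚ⟮x⟯ ℂ).injective y
    simpa [hy] using this
  rw [h1, ← IntermediateField.adjoin.finrank hx]
  exact minpoly.natDegree_le y

/-- A root of a nonzero rational polynomial `f` is integral over `ℚ`, of degree `≤ deg f`.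
[folklore] -/
theorem isIntegral_of_aeval_eq_zero {f : ℚ[X]} (hf : f ≠ 0) {u : ℂ} (hu : aeval u f = 0) :
    IsIntegral ℚ u ∧ (minpoly ℚ u).natDegree ≤ f.natDegree := by
  have halg : IsAlgebraic ℚ u := ⟨f, hf, hu⟩
  exact ⟨halg.isIntegral, Polynomial.natDegree_le_of_dvd (minpoly.dvd ℚ u hu) hf⟩

/-- An element of degree `≤ 1` over `ℚ` is rational. [folklore] -/
theorem exists_rat_of_natDegree_minpoly_le_one {x : ℂ} (hx : IsIntegral ℚ x)
    (h : (minpoly ℚ x).natDegree ≤ 1) : ∃ r : ℚ, x = algebraMap ℚ ℂ r := by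
  have h1 : (minpoly ℚ x).natDegree = 1 := le_antisymm h (minpoly.natDegree_pos hx)
  obtain ⟨r, hr⟩ := minpoly.natDegree_eq_one_iff.1 h1
  exact ⟨r, hr.symm⟩

/-! ### Step 1 (lowering the degree): a rational polynomial with rational values on `S` and
rational critical values -/

/-- Chain rule bookkeeping for Step 1: if `g'` has rational values on `P(S)` and on the critical
values of `P`, and rational critical values itself, then `g' ∘ P` has rational values on `S` and
rational critical values. [cite: BombieriGubler2006, Lemma 12.2.7 (proof, p. 405)] -/
theorem step1_comp {S : Finset ℂ} {P g' : ℚ[X]} (hP : 0 < P.natDegree) (hg' : 0 < g'.natDegree)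
    (hS : ∀ s ∈ S, ∃ r : ℚ, aeval (aeval s P) g' = algebraMap ℚ ℂ r)
    (hcritP : ∀ z : ℂ, aeval z (derivative P) = 0 →
      ∃ r : ℚ, aeval (aeval z P) g' = algebraMap ℚ ℂ r)
    (hcritg : ∀ w : ℂ, aeval w (derivative g') = 0 → ∃ r : ℚ, aeval w g' = algebraMap ℚ ℂ r) :
    0 < (g'.comp P).natDegree ∧
      (∀ s ∈ S, ∃ r : ℚ, aeval s (g'.comp P) = algebraMap ℚ ℂ r) ∧
      ∀ z : ℂ, aeval z (derivative (g'.comp P)) = 0 →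
        ∃ r : ℚ, aeval z (g'.comp P) = algebraMap ℚ ℂ r := by
  refine ⟨?_, ?_, ?_⟩
  · rw [natDegree_comp]; exact Nat.mul_pos hg' hP
  · intro s hs; rw [aeval_comp]; exact hS s hs
  · intro z hz
    rw [derivative_comp, map_mul, mul_eq_zero] at hz
    rw [aeval_comp]
    rcases hz with hz | hz
    · exact hcritP z hz
    · rw [aeval_comp] at hz; exact hcritg _ hz

/-- Step 1, base case: if every point of `S` is rational, `g = x` works. [folklore] -/
theorem step1_base (S : Finset ℂ) (hint : ∀ s ∈ S, IsIntegral ℚ s)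
    (hdeg : ∀ s ∈ S, (minpoly ℚ s).natDegree ≤ 1) :
    ∃ g : ℚ[X], 0 < g.natDegree ∧ (∀ s ∈ S, ∃ r : ℚ, aeval s g = algebraMap ℚ ℂ r) ∧
      ∀ z : ℂ, aeval z (derivative g) = 0 → ∃ r : ℚ, aeval z g = algebraMap ℚ ℂ r := by
  refine ⟨X, by simp, ?_, ?_⟩
  · intro s hs
    obtain ⟨r, hr⟩ := exists_rat_of_natDegree_minpoly_le_one (hint s hs) (hdeg s hs)
    exact ⟨r, by simpa using hr⟩
  · intro z hz
    simp at hz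

/-- Step 1, the reduction step (Bombieri–Gubler p. 405, "Lowering the degree of a point in S"):
composing with the minimal polynomial `p` of a point `α ∈ S` of highest degree `d + 1 ≥ 2` replaces
`S` by `S' = p(S ∪ S₁)`, `S₁` = roots of `p'`, whose points have degree `≤ d + 1` and which has
fewer points of degree `d + 1`. [cite: BombieriGubler2006, Lemma 12.2.7 (proof, p. 405)] -/
theorem step1_reduce {d : ℕ} (hd : 1 ≤ d) (S : Finset ℂ) (hint : ∀ s ∈ S, IsIntegral ℚ s)
    (hdeg : ∀ s ∈ S, (minpoly ℚ s).natDegree ≤ d + 1) {α : ℂ} (hαS : α ∈ S)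
    (hα : (minpoly ℚ α).natDegree = d + 1) :
    ∃ S' : Finset ℂ, (∀ t ∈ S', IsIntegral ℚ t) ∧ (∀ t ∈ S', (minpoly ℚ t).natDegree ≤ d + 1) ∧
      (S'.filter fun t => (minpoly ℚ t).natDegree = d + 1).card <
        (S.filter fun s => (minpoly ℚ s).natDegree = d + 1).card ∧
      (∀ s ∈ S, aeval s (minpoly ℚ α) ∈ S') ∧
      ∀ z : ℂ, aeval z (derivative (minpoly ℚ α)) = 0 → aeval z (minpoly ℚ α) ∈ S' := by
  classical
  set P : ℚ[X] := minpoly ℚ α with hP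
  have hP0 : P.natDegree ≠ 0 := by omega
  have hP' : derivative P ≠ 0 := derivative_ne_zero.2 hP0
  have hP'deg : (derivative P).natDegree = d := by rw [natDegree_derivative, hα]; rfl
  have hmap : (derivative P).map (algebraMap ℚ ℂ) ≠ 0 := Polynomial.map_ne_zero hP'
  set S₁ : Finset ℂ := ((derivative P).map (algebraMap ℚ ℂ)).roots.toFinset with hS₁
  have hS₁mem : ∀ u : ℂ, u ∈ S₁ ↔ aeval u (derivative P) = 0 := by
    intro u
    rw [hS₁, Multiset.mem_toFinset, mem_roots hmap, IsRoot.def, eval_map_algebraMap]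
  have hS₁int : ∀ u ∈ S₁, IsIntegral ℚ u ∧ (minpoly ℚ u).natDegree ≤ d := by
    intro u hu
    have := isIntegral_of_aeval_eq_zero hP' ((hS₁mem u).1 hu)
    exact ⟨this.1, hP'deg ▸ this.2⟩
  set f : ℂ → ℂ := fun u => aeval u P with hf
  refine ⟨(S ∪ S₁).image f, ?_, ?_, ?_, ?_, ?_⟩
  · intro t ht
    obtain ⟨u, hu, rfl⟩ := Finset.mem_image.1 ht
    rcases Finset.mem_union.1 hu with hu | hu
    · exact isIntegral_aeval (hint u hu) P
    · exact isIntegral_aeval (hS₁int u hu).1 P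
  · intro t ht
    obtain ⟨u, hu, rfl⟩ := Finset.mem_image.1 ht
    rcases Finset.mem_union.1 hu with hu | hu
    · exact (natDegree_minpoly_aeval_le (hint u hu) P).trans (hdeg u hu)
    · exact (natDegree_minpoly_aeval_le (hS₁int u hu).1 P).trans ((hS₁int u hu).2.trans
        (Nat.le_succ d))
  · have hsub : ((S ∪ S₁).filter fun u => (minpoly ℚ (f u)).natDegree = d + 1) ⊆
        (S.filter fun s => (minpoly ℚ s).natDegree = d + 1).erase α := by
      intro u hu
      rw [Finset.mem_filter] at hu
      obtain ⟨hu, hfu⟩ := hu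
      rw [Finset.mem_erase, Finset.mem_filter]
      rcases Finset.mem_union.1 hu with huS | huS₁
      · have h1 : (minpoly ℚ (f u)).natDegree ≤ (minpoly ℚ u).natDegree :=
          natDegree_minpoly_aeval_le (hint u huS) P
        refine ⟨?_, huS, le_antisymm (hdeg u huS) (hfu ▸ h1)⟩
        rintro rfl
        have h0 : f u = 0 := by simp [hf, hP]
        rw [h0, minpoly.zero, natDegree_X] at hfu
        omega
      · exfalso
        have h1 : (minpoly ℚ (f u)).natDegree ≤ (minpoly ℚ u).natDegree :=
          natDegree_minpoly_aeval_le (hS₁int u huS₁).1 P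
        have h2 := (hS₁int u huS₁).2
        omega
    calc (((S ∪ S₁).image f).filter fun t => (minpoly ℚ t).natDegree = d + 1).card
        = (((S ∪ S₁).filter fun u => (minpoly ℚ (f u)).natDegree = d + 1).image f).card := by
          rw [Finset.filter_image]
      _ ≤ ((S ∪ S₁).filter fun u => (minpoly ℚ (f u)).natDegree = d + 1).card :=
          Finset.card_image_le
      _ ≤ ((S.filter fun s => (minpoly ℚ s).natDegree = d + 1).erase α).card :=
          Finset.card_le_card hsub
      _ < (S.filter fun s => (minpoly ℚ s).natDegree = d + 1).card :=
          Finset.card_erase_lt_of_mem (Finset.mem_filter.2 ⟨hαS, hα⟩)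
  · intro s hs
    exact Finset.mem_image.2 ⟨s, Finset.mem_union.2 (Or.inl hs), rfl⟩
  · intro z hz
    exact Finset.mem_image.2 ⟨z, Finset.mem_union.2 (Or.inr ((hS₁mem z).2 hz)), rfl⟩


/-- Step 1 at fixed top degree `d + 1 ≥ 2`: induction on the number of points of degree `d + 1`
(Bombieri–Gubler p. 405: "the number of ramification points of highest degree `d ≥ 2` has gone
down at least by 1"). [cite: BombieriGubler2006, Lemma 12.2.7 (proof, p. 405)] -/
theorem step1_succ {d : ℕ} (hd : 1 ≤ d)
    (ih : ∀ S : Finset ℂ, (∀ s ∈ S, IsIntegral ℚ s) → (∀ s ∈ S, (minpoly ℚ s).natDegree ≤ d) →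
      ∃ g : ℚ[X], 0 < g.natDegree ∧ (∀ s ∈ S, ∃ r : ℚ, aeval s g = algebraMap ℚ ℂ r) ∧
        ∀ z : ℂ, aeval z (derivative g) = 0 → ∃ r : ℚ, aeval z g = algebraMap ℚ ℂ r) (N : ℕ) :
    ∀ S : Finset ℂ, (S.filter fun s => (minpoly ℚ s).natDegree = d + 1).card = N →
      (∀ s ∈ S, IsIntegral ℚ s) → (∀ s ∈ S, (minpoly ℚ s).natDegree ≤ d + 1) →
      ∃ g : ℚ[X], 0 < g.natDegree ∧ (∀ s ∈ S, ∃ r : ℚ, aeval s g = algebraMap ℚ ℂ r) ∧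
        ∀ z : ℂ, aeval z (derivative g) = 0 → ∃ r : ℚ, aeval z g = algebraMap ℚ ℂ r := by
  induction N using Nat.strong_induction_on with
  | _ N ihN =>
    intro S hN hint hdeg
    by_cases h0 : (S.filter fun s => (minpoly ℚ s).natDegree = d + 1) = ∅
    · -- no point of degree `d + 1`: all degrees are `≤ d`
      refine ih S hint fun s hs => ?_
      have h1 := hdeg s hs
      have h2 : ¬ (minpoly ℚ s).natDegree = d + 1 := fun h =>
        (Finset.eq_empty_iff_forall_notMem.1 h0) s (Finset.mem_filter.2 ⟨hs, h⟩)
      omega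
    · obtain ⟨α, hα⟩ := Finset.nonempty_iff_ne_empty.2 h0
      rw [Finset.mem_filter] at hα
      obtain ⟨S', hint', hdeg', hlt, hS, hcrit⟩ := step1_reduce hd S hint hdeg hα.1 hα.2
      obtain ⟨g', hg'pos, hg'S, hg'crit⟩ := ihN _ (hN ▸ hlt) S' rfl hint' hdeg'
      have hP : 0 < (minpoly ℚ α).natDegree := by omega
      exact ⟨g'.comp (minpoly ℚ α), step1_comp hP hg'pos (fun s hs => hg'S _ (hS s hs))
        (fun z hz => hg'S _ (hcrit z hz)) hg'crit⟩

/-- **Step 1** (Bombieri–Gubler p. 405, "Lowering the degree"; Belyi): for every finite set `S` of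
algebraic numbers there is a non-constant `g ∈ ℚ[x]` with `g(S) ⊂ ℚ` and all critical values of
`g` in `ℚ`. Induction on the top degree `d`.
[cite: BombieriGubler2006, Lemma 12.2.7 (proof, p. 405)] -/
theorem step1 (d : ℕ) : ∀ S : Finset ℂ, (∀ s ∈ S, IsIntegral ℚ s) →
    (∀ s ∈ S, (minpoly ℚ s).natDegree ≤ d) →
    ∃ g : ℚ[X], 0 < g.natDegree ∧ (∀ s ∈ S, ∃ r : ℚ, aeval s g = algebraMap ℚ ℂ r) ∧
      ∀ z : ℂ, aeval z (derivative g) = 0 → ∃ r : ℚ, aeval z g = algebraMap ℚ ℂ r := by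
  induction d with
  | zero => exact fun S hint hdeg => step1_base S hint fun s hs => (hdeg s hs).trans zero_le_one
  | succ d ih =>
    intro S hint hdeg
    rcases Nat.eq_zero_or_pos d with rfl | hd
    · exact step1_base S hint (by simpa using hdeg)
    · exact step1_succ hd ih _ S rfl hint hdeg


/-! ### Step 2 (lowering the cardinality): Belyi polynomials `c x^A (1-x)^B` on rational sets -/

/-- Logarithmic derivative of the Belyi polynomial `β = c x^(m+1) (1-x)^(n+1)`:
`β' · x (1 - x) = β · ((m+1)(1-x) - (n+1) x)` (Bombieri–Gubler p. 406: `h'/h = A/x - B/(1-x)`).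
[cite: BombieriGubler2006, Lemma 12.2.7 (proof, p. 406)] -/
theorem belyiPoly_derivative_mul (c : ℚ) (m n : ℕ) :
    derivative (C c * X ^ (m + 1) * (1 - X) ^ (n + 1)) * (X * (1 - X)) =
      (C c * X ^ (m + 1) * (1 - X) ^ (n + 1)) *
        (C (m + 1 : ℚ) * (1 - X) - C (n + 1 : ℚ) * X) := by
  simp only [derivative_mul, derivative_C, zero_mul, zero_add, derivative_pow_succ,
    derivative_sub, derivative_one, derivative_X, zero_sub, mul_neg, mul_one]
  ring

/-- Values of the Belyi polynomial at `0` and `1`. [folklore] -/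
theorem belyiPoly_eval_zero_one (c : ℚ) (m n : ℕ) :
    (C c * X ^ (m + 1) * (1 - X) ^ (n + 1)).eval 0 = 0 ∧
      (C c * X ^ (m + 1) * (1 - X) ^ (n + 1)).eval 1 = 0 := by
  constructor <;> simp

/-- With `c = λ^{-A} (1-λ)^{-B}` one has `β(λ) = 1` (Bombieri–Gubler p. 406).
[cite: BombieriGubler2006, Lemma 12.2.7 (proof, p. 406)] -/
theorem belyiPoly_eval_lambda {q : ℚ} (hq0 : q ≠ 0) (hq1 : q ≠ 1) (m n : ℕ) :
    (C (q ^ (m + 1) * (1 - q) ^ (n + 1))⁻¹ * X ^ (m + 1) * (1 - X) ^ (n + 1)).eval q = 1 := by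
  have h : q ^ (m + 1) * (1 - q) ^ (n + 1) ≠ 0 :=
    mul_ne_zero (pow_ne_zero _ hq0) (pow_ne_zero _ (sub_ne_zero.2 (Ne.symm hq1)))
  simp only [eval_mul, eval_C, eval_pow, eval_X, eval_sub, eval_one]
  rw [mul_assoc, inv_mul_cancel₀ h]

/-- The Belyi polynomial `β = c x^(m+1) (1-x)^(n+1)`, `c = λ^{-(m+1)} (1-λ)^{-(n+1)}`,
`λ = (m+1)/(m+n+2)`, is ramified (at finite points) only over `{0, 1}`: at a complex zero `w` of
`β'` one has `β(w) ∈ {0, 1}` (Bombieri–Gubler p. 406: `h'/h` vanishes only at `∞` or `λ`, and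
`h(λ) = 1`). [cite: BombieriGubler2006, Lemma 12.2.7 (proof, p. 406)] -/
theorem belyiPoly_critical {q : ℚ} {m n : ℕ} (hq : q = (m + 1 : ℚ) / (m + n + 2 : ℚ)) (w : ℂ)
    (hw : aeval w (derivative
      (C (q ^ (m + 1) * (1 - q) ^ (n + 1))⁻¹ * X ^ (m + 1) * (1 - X) ^ (n + 1))) = 0) :
    aeval w (C (q ^ (m + 1) * (1 - q) ^ (n + 1))⁻¹ * X ^ (m + 1) * (1 - X) ^ (n + 1)) = 0 ∨
      aeval w (C (q ^ (m + 1) * (1 - q) ^ (n + 1))⁻¹ * X ^ (m + 1) * (1 - X) ^ (n + 1)) = 1 := by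
  set c : ℚ := (q ^ (m + 1) * (1 - q) ^ (n + 1))⁻¹ with hc
  have hmn : ((m : ℂ) + n + 2) ≠ 0 := by
    have : ((m + n + 2 : ℕ) : ℂ) ≠ 0 := Nat.cast_ne_zero.2 (by omega)
    push_cast at this
    exact this
  have hq0 : 0 < q := by
    rw [hq]; positivity
  have hq1 : q < 1 := by
    rw [hq, div_lt_one (by positivity)]
    linarith
  have key := congrArg (aeval w) (belyiPoly_derivative_mul c m n)
  rw [map_mul, hw, zero_mul, map_mul] at key
  rcases mul_eq_zero.1 key.symm with h | h
  · exact Or.inl h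
  · right
    have hw' : w = algebraMap ℚ ℂ q := by
      simp only [map_sub, map_mul, aeval_C, aeval_X, map_one, eq_ratCast] at h
      push_cast at h
      rw [hq, eq_ratCast]
      push_cast
      rw [eq_div_iff hmn]
      linear_combination -h
    rw [hw', aeval_algebraMap_apply_eq_algebraMap_eval, belyiPoly_eval_lambda hq0.ne' hq1.ne,
      map_one]


/-- A rational number in `(0, 1)` is `A/(A+B)` with `A, B` positive integers. [folklore] -/
theorem exists_nat_eq_div_of_pos_lt_one {q : ℚ} (h0 : 0 < q) (h1 : q < 1) :
    ∃ m n : ℕ, q = (m + 1 : ℚ) / (m + n + 2 : ℚ) := by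
  have hnum : 0 < q.num := Rat.num_pos.2 h0
  have hlt : q.num < q.den := Rat.num_lt_denom_iff.2 h1
  obtain ⟨m, hm⟩ : ∃ m : ℕ, q.num = (m : ℤ) + 1 := by
    refine ⟨(q.num - 1).toNat, ?_⟩
    rw [Int.toNat_of_nonneg (by omega)]; ring
  obtain ⟨n, hn⟩ : ∃ n : ℕ, (q.den : ℤ) = q.num + n + 1 := by
    refine ⟨((q.den : ℤ) - q.num - 1).toNat, ?_⟩
    rw [Int.toNat_of_nonneg (by omega)]; ring
  refine ⟨m, n, ?_⟩
  have hden : (q.den : ℚ) = (m : ℚ) + n + 2 := by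
    have : ((q.den : ℤ) : ℚ) = ((q.num + n + 1 : ℤ) : ℚ) := by rw [hn]
    push_cast at this
    rw [this, hm]; push_cast; ring
  have hnum' : (q.num : ℚ) = (m : ℚ) + 1 := by rw [hm]; push_cast; ring
  rw [← hden, ← hnum', Rat.num_div_den]

/-- The affine map `x ↦ (x - a)/(b - a)` (a projective automorphism fixing `∞`): degree `1`,
`a ↦ 0`, `b ↦ 1`, no critical points. [folklore] -/
theorem affine_props {a b : ℚ} (hab : a ≠ b) :
    (C (b - a)⁻¹ * (X - C a)).natDegree = 1 ∧ (C (b - a)⁻¹ * (X - C a)).eval a = 0 ∧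
      (C (b - a)⁻¹ * (X - C a)).eval b = 1 ∧
      derivative (C (b - a)⁻¹ * (X - C a)) = C (b - a)⁻¹ := by
  have hba : b - a ≠ 0 := sub_ne_zero.2 (Ne.symm hab)
  refine ⟨?_, ?_, ?_, ?_⟩
  · rw [natDegree_C_mul (inv_ne_zero hba), natDegree_X_sub_C]
  · simp
  · simp only [eval_mul, eval_C, eval_sub, eval_X]
    exact inv_mul_cancel₀ hba
  · simp

/-- Values in `{0, 1}` are inherited through composition at rational fibres. [folklore] -/
theorem aeval_comp_mem {F P : ℚ[X]} {T : Finset ℚ} (hFT : ∀ t ∈ T, F.eval t = 0 ∨ F.eval t = 1)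
    {z : ℂ} (hz : ∃ t ∈ T, aeval z P = algebraMap ℚ ℂ t) :
    aeval z (F.comp P) = 0 ∨ aeval z (F.comp P) = 1 := by
  obtain ⟨t, ht, hzt⟩ := hz
  rw [aeval_comp, hzt, aeval_algebraMap_apply_eq_algebraMap_eval]
  rcases hFT t ht with h | h
  · exact Or.inl (by rw [h, map_zero])
  · exact Or.inr (by rw [h, map_one])

/-- Chain rule (Bombieri–Gubler p. 405: "by the chain rule we may replace S by …"): if `F` is
unramified outside `F⁻¹{0, 1, ∞}` at finite points and takes values in `{0,1}` on `T`, and the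
critical values of `P` lie in `T`, then `F ∘ P` is unramified outside `(F ∘ P)⁻¹{0, 1, ∞}` at finite
points. [cite: BombieriGubler2006, Lemma 12.2.7 (proof, p. 405)] -/
theorem comp_critical {F P : ℚ[X]} {T : Finset ℚ} (hFT : ∀ t ∈ T, F.eval t = 0 ∨ F.eval t = 1)
    (hFcrit : ∀ w : ℂ, aeval w (derivative F) = 0 → aeval w F = 0 ∨ aeval w F = 1)
    (hPcrit : ∀ z : ℂ, aeval z (derivative P) = 0 → ∃ t ∈ T, aeval z P = algebraMap ℚ ℂ t)
    (z : ℂ) (hz : aeval z (derivative (F.comp P)) = 0) :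
    aeval z (F.comp P) = 0 ∨ aeval z (F.comp P) = 1 := by
  rw [derivative_comp, map_mul, mul_eq_zero] at hz
  rcases hz with hz | hz
  · exact aeval_comp_mem hFT (hPcrit z hz)
  · rw [aeval_comp] at hz ⊢
    exact hFcrit _ hz

/-- **Step 2** (Bombieri–Gubler p. 406, "Lowering the cardinality of S"; Belyi): for every finite
set `T ⊂ ℚ` there is a non-constant POLYNOMIAL `f ∈ ℚ[x]` with `f(T) ⊆ {0, 1}` all of whose
(finite) critical values lie in `{0, 1}`.  Induction on `|T|`: normalise `min T ↦ 0`, `max T ↦ 1`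
by an affine map (so a fourth point `λ` lies in `(0,1)`, i.e. `A, B > 0` and the Belyi function
`c x^A (1-x)^B` is a polynomial), then compose with it: `0, 1, λ ↦ 0, 0, 1` loses a point.
[cite: BombieriGubler2006, Lemma 12.2.7 (proof, p. 406)] -/
theorem step2 (N : ℕ) : ∀ T : Finset ℚ, T.card = N →
    ∃ f : ℚ[X], 0 < f.natDegree ∧ (∀ t ∈ T, f.eval t = 0 ∨ f.eval t = 1) ∧
      ∀ z : ℂ, aeval z (derivative f) = 0 → aeval z f = 0 ∨ aeval z f = 1 := by
  induction N using Nat.strong_induction_on with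
  | _ N ihN =>
    intro T hT
    -- small sets: an affine map (no critical points) suffices
    have small : ∀ a b : ℚ, a ≠ b → (∀ t ∈ T, t = a ∨ t = b) →
        ∃ f : ℚ[X], 0 < f.natDegree ∧ (∀ t ∈ T, f.eval t = 0 ∨ f.eval t = 1) ∧
          ∀ z : ℂ, aeval z (derivative f) = 0 → aeval z f = 0 ∨ aeval z f = 1 := by
      intro a b hab hTab
      obtain ⟨hdeg, ha, hb, hder⟩ := affine_props hab
      refine ⟨C (b - a)⁻¹ * (X - C a), by omega, ?_, ?_⟩
      · intro t ht
        rcases hTab t ht with rfl | rfl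
        · exact Or.inl ha
        · exact Or.inr hb
      · intro z hz
        rw [hder, aeval_C, map_eq_zero_iff _ (algebraMap ℚ ℂ).injective, inv_eq_zero,
          sub_eq_zero] at hz
        exact absurd hz.symm hab
    rcases Nat.lt_or_ge T.card 3 with h3 | h3
    · have h012 : T.card = 0 ∨ T.card = 1 ∨ T.card = 2 := by omega
      rcases h012 with h0 | h1 | h2
      · rw [Finset.card_eq_zero] at h0
        subst h0
        exact small 0 1 zero_ne_one (by simp)
      · obtain ⟨a, rfl⟩ := Finset.card_eq_one.1 h1
        exact small a (a + 1) (by linarith) (by simp)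
      · obtain ⟨a, b, hab, rfl⟩ := Finset.card_eq_two.1 h2
        exact small a b hab (by simp)
    -- `|T| ≥ 3`: normalise and compose with a Belyi polynomial
    have hne : T.Nonempty := Finset.card_pos.1 (by omega)
    set a := T.min' hne with ha
    set b := T.max' hne with hb
    have hab : a < b := by
      rw [ha, hb]; exact Finset.min'_lt_max'_of_card T (by omega)
    obtain ⟨t₀, ht₀, ht₀b⟩ := Finset.exists_mem_ne
      (show 1 < (T.erase a).card by rw [Finset.card_erase_of_mem (Finset.min'_mem T hne)]; omega) b
    obtain ⟨ht₀a, ht₀T⟩ := Finset.mem_erase.1 ht₀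
    have hat₀ : a < t₀ := lt_of_le_of_ne (Finset.min'_le T t₀ ht₀T) (Ne.symm ht₀a)
    have ht₀b' : t₀ < b := lt_of_le_of_ne (Finset.le_max' T t₀ ht₀T) ht₀b
    -- the affine normalisation `A` and the fourth point `λ = A(t₀) ∈ (0,1)`
    set A : ℚ[X] := C (b - a)⁻¹ * (X - C a) with hA
    obtain ⟨hAdeg, hAa, hAb, hAder⟩ := affine_props hab.ne
    have hba : 0 < b - a := sub_pos.2 hab
    set q : ℚ := A.eval t₀ with hq
    have hqval : q = (b - a)⁻¹ * (t₀ - a) := by simp [hq, hA]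
    have hq0 : 0 < q := by rw [hqval]; exact mul_pos (inv_pos.2 hba) (sub_pos.2 hat₀)
    have hq1 : q < 1 := by
      rw [hqval, inv_mul_lt_iff₀ hba]; linarith
    obtain ⟨m, n, hmn⟩ := exists_nat_eq_div_of_pos_lt_one hq0 hq1
    set β : ℚ[X] := C (q ^ (m + 1) * (1 - q) ^ (n + 1))⁻¹ * X ^ (m + 1) * (1 - X) ^ (n + 1)
      with hβ
    obtain ⟨hβ0, hβ1⟩ := belyiPoly_eval_zero_one (q ^ (m + 1) * (1 - q) ^ (n + 1))⁻¹ m n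
    have hβq : β.eval q = 1 := belyiPoly_eval_lambda hq0.ne' hq1.ne m n
    set φ : ℚ[X] := β.comp A with hφ
    have hφa : φ.eval a = 0 := by rw [hφ, eval_comp, hAa, hβ0]
    have hφb : φ.eval b = 0 := by rw [hφ, eval_comp, hAb, hβ1]
    have hφt₀ : φ.eval t₀ = 1 := by rw [hφ, eval_comp, ← hq, hβq]
    -- the new, smaller set `T' = φ(T)`
    set T' : Finset ℚ := T.image fun t => φ.eval t with hT'
    have hcard : T'.card < T.card := by
      have hle : T'.card ≤ T.card := Finset.card_image_le
      have hne' : T'.card ≠ T.card := by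
        intro h
        have hinj := (Finset.card_image_iff.1 h) (Finset.min'_mem T hne) (Finset.max'_mem T hne)
          (by simp only; rw [← ha, ← hb, hφa, hφb])
        exact hab.ne (by rw [ha, hb]; exact hinj)
      omega
    obtain ⟨F, hFdeg, hFT, hFcrit⟩ := ihN T'.card (hT ▸ hcard) T' rfl
    have h0T' : (0 : ℚ) ∈ T' := Finset.mem_image.2 ⟨a, Finset.min'_mem T hne, hφa⟩
    have h1T' : (1 : ℚ) ∈ T' := Finset.mem_image.2 ⟨t₀, ht₀T, hφt₀⟩
    -- critical points of `φ = β ∘ A` map to `0` or `1`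
    have hφcrit : ∀ z : ℂ, aeval z (derivative φ) = 0 →
        ∃ t ∈ T', aeval z φ = algebraMap ℚ ℂ t := by
      intro z hz
      rw [hφ, derivative_comp, hAder, map_mul, aeval_C, mul_eq_zero,
        map_eq_zero_iff _ (algebraMap ℚ ℂ).injective, inv_eq_zero] at hz
      rcases hz with hz | hz
      · exact absurd hz hba.ne'
      · rw [aeval_comp] at hz
        rcases belyiPoly_critical hmn _ hz with h | h
        · exact ⟨0, h0T', by rw [hφ, aeval_comp, h, map_zero]⟩
        · exact ⟨1, h1T', by rw [hφ, aeval_comp, h, map_one]⟩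
    have hφdeg : 0 < φ.natDegree := by
      rw [Nat.pos_iff_ne_zero]
      intro h
      have hc := eq_C_of_natDegree_eq_zero h
      have h1 : φ.eval a = φ.eval t₀ := by rw [hc, eval_C, eval_C]
      rw [hφa, hφt₀] at h1
      exact zero_ne_one h1
    refine ⟨F.comp φ, ?_, ?_, ?_⟩
    · rw [natDegree_comp]; exact Nat.mul_pos hFdeg hφdeg
    · intro t ht
      rw [eval_comp]
      exact hFT _ (Finset.mem_image.2 ⟨t, ht, rfl⟩)
    · exact comp_critical hFT hFcrit hφcrit


/-- **Steps 1 + 2 combined**: for every finite set `S` of algebraic numbers there is a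
non-constant polynomial `h ∈ ℚ[x]` with `h(S) ⊆ {0, 1}` whose finite critical values lie in
`{0, 1}` — a polynomial Belyi function for `S ∪ {∞}` defined over `ℚ`.
[cite: BombieriGubler2006, Lemma 12.2.7 (proof, pp. 405–406)] -/
theorem exists_belyi_polynomial (S : Finset ℂ) (hS : ∀ s ∈ S, IsAlgebraic ℚ s) :
    ∃ h : ℚ[X], 0 < h.natDegree ∧
      (∀ z : ℂ, aeval z (derivative h) = 0 → aeval z h = 0 ∨ aeval z h = 1) ∧
      ∀ s ∈ S, aeval s h = 0 ∨ aeval s h = 1 := by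
  classical
  have hint : ∀ s ∈ S, IsIntegral ℚ s := fun s hs => (hS s hs).isIntegral
  -- Step 1: `g` with `g(S) ⊂ ℚ` and rational critical values
  obtain ⟨g, hgdeg, hgS, hgcrit⟩ := step1 (S.sup fun s => (minpoly ℚ s).natDegree) S hint
    (fun s hs => Finset.le_sup (f := fun s => (minpoly ℚ s).natDegree) hs)
  -- the finite set `T = g(S ∪ {critical points of g}) ⊂ ℚ`
  have hg' : (derivative g).map (algebraMap ℚ ℂ) ≠ 0 :=
    Polynomial.map_ne_zero (derivative_ne_zero.2 hgdeg.ne')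
  set CP : Finset ℂ := ((derivative g).map (algebraMap ℚ ℂ)).roots.toFinset with hCP
  have hCPmem : ∀ z : ℂ, aeval z (derivative g) = 0 → z ∈ CP := by
    intro z hz
    rw [hCP, Multiset.mem_toFinset, mem_roots hg', IsRoot.def, eval_map_algebraMap]
    exact hz
  have hinj : Set.InjOn (algebraMap ℚ ℂ)
      ((algebraMap ℚ ℂ) ⁻¹' ↑((S ∪ CP).image fun u => aeval u g)) :=
    (algebraMap ℚ ℂ).injective.injOn
  set T : Finset ℚ := ((S ∪ CP).image fun u => aeval u g).preimage (algebraMap ℚ ℂ) hinj with hT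
  have hTS : ∀ s ∈ S, ∃ t ∈ T, aeval s g = algebraMap ℚ ℂ t := by
    intro s hs
    obtain ⟨r, hr⟩ := hgS s hs
    refine ⟨r, ?_, hr⟩
    rw [hT, Finset.mem_preimage, ← hr]
    exact Finset.mem_image.2 ⟨s, Finset.mem_union.2 (Or.inl hs), rfl⟩
  have hTcrit : ∀ z : ℂ, aeval z (derivative g) = 0 → ∃ t ∈ T, aeval z g = algebraMap ℚ ℂ t := by
    intro z hz
    obtain ⟨r, hr⟩ := hgcrit z hz
    refine ⟨r, ?_, hr⟩
    rw [hT, Finset.mem_preimage, ← hr]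
    exact Finset.mem_image.2 ⟨z, Finset.mem_union.2 (Or.inr (hCPmem z hz)), rfl⟩
  -- Step 2 on `T`
  obtain ⟨F, hFdeg, hFT, hFcrit⟩ := step2 T.card T rfl
  refine ⟨F.comp g, ?_, comp_critical hFT hFcrit hTcrit, fun s hs => aeval_comp_mem hFT (hTS s hs)⟩
  rw [natDegree_comp]; exact Nat.mul_pos hFdeg hgdeg

end BelyiAlgorithm

/-- **Belyi's lemma in genus `0` over `ℚ` holds** (discharge of the named fact
`BelyiLemmaGenusZero`, [cite: BombieriGubler2006, Lemma 12.2.7]).  The witness is even a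
POLYNOMIAL: `p = h`, `q = 1` with `h` from `exists_belyi_polynomial` (so `h(∞) = ∞`, the second
disjunct `deg q < d` of the `∞`-clause holds, and the ramification clause reads
`h'(z) = 0 → h(z) ∈ {0, 1}`). -/
theorem BelyiLemmaGenusZero_holds : BelyiLemmaGenusZero := by
  intro S hS
  obtain ⟨h, hdeg, hcrit, hval⟩ := BelyiAlgorithm.exists_belyi_polynomial S hS
  have hmax : max h.natDegree (1 : ℚ[X]).natDegree = h.natDegree := by
    rw [natDegree_one, Nat.max_eq_left (Nat.zero_le _)]
  refine ⟨h, 1, isCoprime_one_right, ?_, ?_, ?_, ?_⟩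
  · rw [hmax]; exact hdeg
  · exact Or.inr (Or.inl (by rw [hmax, natDegree_one]; exact hdeg))
  · intro z _ hz
    simp only [derivative_one, mul_zero, sub_zero, mul_one, eval_map_algebraMap,
      Polynomial.map_one, eval_one] at hz ⊢
    exact hcrit z hz
  · intro s hs
    simp only [mul_one, Polynomial.map_mul, Polynomial.map_sub, Polynomial.map_one, eval_mul,
      eval_sub, eval_one, eval_map_algebraMap]
    rcases hval s hs with h0 | h1
    · rw [h0, zero_mul]
    · rw [h1, sub_self, mul_zero]

end Literature.NumberTheory.DiophantineGeometry
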